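import Mathlib.Analysis.SpecialFunctions.Integrals.Basic
import Mathlib.Analysis.SpecialFunctions.Integrability.Basic
import Mathlib.MeasureTheory.Integral.DominatedConvergence
import Mathlib.Analysis.SpecialFunctions.Trigonometric.InverseDeriv
import Literature.Probability.RandomPlanarGeometry.RectangleModulusElliptic
import HarnessLib

/-!
# Basic real analysis of the complete elliptic integral `K(u) = ∫₀¹ dt/√((1-t²)(1-u t²))`

API for the tree's `Literature.Probability.RandomPlanarGeometry.ellipticK` (defined in
`RectangleModulus.lean`, Abramowitz–Stegun PARAMETER convention `u = k²`) AS A FUNCTION OF THE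
PARAMETER `u`, all proved, in the vocabulary of `RectangleModulusElliptic.lean`
(`ellIntegrand u t = 1/√((1-t²)(1-u t²))`, `ellipticK_eq : ellipticK u = ∫₀¹ ellIntegrand u`;
that file treats the incomplete integral `ellipticF u x` as a function of `x` for FIXED
`0 ≤ u < 1` — positivity, integrability, monotonicity and continuity in `x` — which is not what
is needed here):

* `intervalIntegrable_ellIntegrand_of_lt_one` — for every `u < 1` (no sign condition) the
  integrand is Lebesgue integrable on `[0,1]` (bound `(min 1 (1-u₁))^{-1/2} (1-t)^{-1/2}`
  uniformly in `u ≤ u₁ < 1`, `ellIntegrand_le_uniform`);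
* `ellipticK_nonneg`, `ellipticK_mono`, `ellipticK_strictMonoOn`, `ellipticK_zero`,
  `pi_div_two_le_ellipticK` — `K` is nonnegative and (strictly) monotone on `(-∞, 1)`,
  `K(0) = π/2`;
* `continuousAt_ellipticK` — `K` is continuous at every `u < 1` (dominated convergence);
* `log_le_ellipticK`, `ellipticK_unbounded` — `K(u) ≥ ½ log((3-u)/(1-u))`, hence `K(u) → ∞` as
  `u → 1⁻` (from the pointwise bound `√((1-t²)(1-u t²)) ≤ 2(1-t) + (1-u)`);
* `exists_ellipticK_compl_eq_mul`, `existsUnique_ellipticK_compl_eq_mul` — for every `c > 0`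
  there is exactly one modulus `0 < k < 1` with `K′(k) = c · K(k)`, i.e.
  `ellipticK (1 - k²) = c · ellipticK (k²)` (intermediate value theorem + strict monotonicity).
  With `c = √N` (`existsUnique_singularModulus`) this is the `N`-th singular modulus `k_N` of
  Borwein–Borwein, *Pi and the AGM* (1987), Ch. 4–5 (`K′(k_N)/K(k_N) = √N`); its existence is
  the `∃ k` clause of `Literature.Analysis.FunctionSpaces.BorweinStraubWanZudilin2012_eq_5_3`
  (`N = 15`), and uniqueness makes that clause determinate.

Not here: Legendre's relation, the AGM, singular VALUES `K(k_N)` in Gamma-function terms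
(Chowla–Selberg / Borwein–Zucker) — none is in Mathlib either.

## References

* J. M. Borwein, P. B. Borwein, *Pi and the AGM*, Wiley (1987), §1.3 (complete elliptic integrals),
  Ch. 4–5 (singular moduli `k_N`).
* M. Abramowitz, I. Stegun, *Handbook of Mathematical Functions*, 17.3 (parameter convention).
-/

noncomputable section

open _root_.MeasureTheory _root_.Set _root_.Filter intervalIntegral
open scoped _root_.Topology

namespace Literature.Probability.RandomPlanarGeometry

/-! ### Pointwise bounds on the integrand `1/√((1-t²)(1-u t²))` -/

/-- Lower bound on the radicand, uniform in `u ≤ u₁ < 1`: for `t ∈ [0,1]`,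
`min 1 (1-u₁) · (1-t) ≤ (1-t²)(1-u t²)`. [folklore] -/
theorem ellipticK_radicand_ge {u u₁ t : ℝ} (hu : u ≤ u₁) (hu₁ : u₁ < 1) (ht0 : 0 ≤ t) (ht1 : t ≤ 1) :
    min 1 (1 - u₁) * (1 - t) ≤ (1 - t ^ 2) * (1 - u * t ^ 2) := by
  have hm : 0 < min 1 (1 - u₁) := lt_min one_pos (by linarith)
  have h1 : 1 - t ≤ 1 - t ^ 2 := by nlinarith
  have ht2 : t ^ 2 ≤ 1 := by nlinarith
  have h2 : min 1 (1 - u₁) ≤ 1 - u * t ^ 2 := by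
    rcases le_or_gt u 0 with hu0 | hu0
    · calc min 1 (1 - u₁) ≤ 1 := min_le_left _ _
        _ ≤ 1 - u * t ^ 2 := by nlinarith [sq_nonneg t]
    · calc min 1 (1 - u₁) ≤ 1 - u₁ := min_le_right _ _
        _ ≤ 1 - u * t ^ 2 := by nlinarith
  calc min 1 (1 - u₁) * (1 - t) ≤ (1 - u * t ^ 2) * (1 - t) :=
        mul_le_mul_of_nonneg_right h2 (by linarith)
    _ ≤ (1 - u * t ^ 2) * (1 - t ^ 2) := mul_le_mul_of_nonneg_left h1 (by linarith)
    _ = (1 - t ^ 2) * (1 - u * t ^ 2) := mul_comm _ _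

/-- The integrable majorant: for `u ≤ u₁ < 1` and `t ∈ [0,1)`,
`1/√((1-t²)(1-u t²)) ≤ (min 1 (1-u₁))^{-1/2} · (1-t)^{-1/2}`. [folklore] -/
theorem ellIntegrand_le_uniform {u u₁ t : ℝ} (hu : u ≤ u₁) (hu₁ : u₁ < 1) (ht0 : 0 ≤ t)
    (ht1 : t < 1) :
    ellIntegrand u t ≤ (min 1 (1 - u₁)) ^ (-(1 / 2 : ℝ)) * (1 - t) ^ (-(1 / 2 : ℝ)) := by
  unfold ellIntegrand
  have hm : 0 < min 1 (1 - u₁) := lt_min one_pos (by linarith)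
  have hrad := ellipticK_radicand_ge hu hu₁ ht0 ht1.le
  have hpos : 0 < min 1 (1 - u₁) * (1 - t) := mul_pos hm (by linarith)
  rw [← Real.mul_rpow hm.le (by linarith), Real.rpow_neg hpos.le, ← Real.sqrt_eq_rpow, ← one_div]
  exact one_div_le_one_div_of_le (Real.sqrt_pos.mpr hpos) (Real.sqrt_le_sqrt hrad)

/-- The divergent minorant: for `u ≤ 1` and `t ∈ [0,1)`,
`1/(2(1-t) + (1-u)) ≤ 1/√((1-t²)(1-u t²))` (since `1-t² ≤ 2(1-t)` and
`1-u t² = (1-t²) + (1-u)t² ≤ 2(1-t) + (1-u)`). [folklore] -/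
theorem one_div_le_ellIntegrand {u t : ℝ} (hu : u ≤ 1) (ht0 : 0 ≤ t) (ht1 : t < 1) :
    1 / (2 * (1 - t) + (1 - u)) ≤ ellIntegrand u t := by
  unfold ellIntegrand
  have ht2 : t ^ 2 ≤ 1 := by nlinarith
  have h1 : 1 - t ^ 2 ≤ 2 * (1 - t) := by nlinarith
  have h1' : 0 < 1 - t ^ 2 := by nlinarith
  have h2 : 1 - u * t ^ 2 ≤ 2 * (1 - t) + (1 - u) := by nlinarith
  have h2' : 0 < 1 - u * t ^ 2 := by nlinarith
  have hD : 0 < 2 * (1 - t) + (1 - u) := by linarith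
  apply one_div_le_one_div_of_le (Real.sqrt_pos.mpr (mul_pos h1' h2'))
  rw [show 2 * (1 - t) + (1 - u) = Real.sqrt ((2 * (1 - t) + (1 - u)) ^ 2) by
    rw [Real.sqrt_sq hD.le]]
  apply Real.sqrt_le_sqrt
  calc (1 - t ^ 2) * (1 - u * t ^ 2) ≤ (2 * (1 - t)) * (2 * (1 - t) + (1 - u)) :=
        mul_le_mul h1 h2 h2'.le (by linarith)
    _ ≤ (2 * (1 - t) + (1 - u)) ^ 2 := by nlinarith

/-! ### Integrability, positivity, monotonicity -/

/-- For every `u < 1` the integrand of `ellipticK u` is integrable on `[0,1]` (its only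
singularity, at `t = 1`, is of order `(1-t)^{-1/2}`); compare
`intervalIntegrable_ellIntegrand`, which assumes `0 ≤ u`. [folklore] -/
theorem intervalIntegrable_ellIntegrand_of_lt_one {u : ℝ} (hu : u < 1) :
    IntervalIntegrable (ellIntegrand u) volume 0 1 := by
  have hb : IntervalIntegrable
      (fun t : ℝ => (min 1 (1 - u)) ^ (-(1 / 2 : ℝ)) * (1 - t) ^ (-(1 / 2 : ℝ))) volume 0 1 := by
    have h := (intervalIntegral.intervalIntegrable_rpow' (a := 1) (b := 0)
      (show (-1 : ℝ) < -(1 / 2) by norm_num)).comp_sub_left 1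
    simp only [sub_self, sub_zero] at h
    exact h.const_mul _
  refine hb.mono_fun' (measurable_ellIntegrand u).aestronglyMeasurable ?_
  rw [uIoc_of_le zero_le_one]
  refine (ae_restrict_mem measurableSet_Ioc).mono fun t ht => ?_
  dsimp only
  rw [Real.norm_eq_abs, abs_of_nonneg (ellIntegrand_nonneg u t)]
  rcases lt_or_eq_of_le ht.2 with h1 | h1
  · exact ellIntegrand_le_uniform le_rfl hu ht.1.le h1
  · subst h1
    have h0 : (1 - (1 : ℝ)) ^ (-(1 / 2 : ℝ)) = 0 := by rw [sub_self, Real.zero_rpow (by norm_num)]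
    rw [h0, mul_zero]
    simp [ellIntegrand]

/-- `0 ≤ K(u)` for every `u` (the integrand is nonnegative). [folklore] -/
theorem ellipticK_nonneg (u : ℝ) : 0 ≤ ellipticK u :=
  intervalIntegral.integral_nonneg zero_le_one fun t _ => ellIntegrand_nonneg u t

/-- `K` is monotone on `(-∞, 1)`: `u ≤ v < 1 → K(u) ≤ K(v)`. [folklore] -/
theorem ellipticK_mono {u v : ℝ} (huv : u ≤ v) (hv : v < 1) : ellipticK u ≤ ellipticK v := by
  rw [ellipticK_eq, ellipticK_eq]
  refine intervalIntegral.integral_mono_on zero_le_one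
    (intervalIntegrable_ellIntegrand_of_lt_one (lt_of_le_of_lt huv hv))
    (intervalIntegrable_ellIntegrand_of_lt_one hv) fun t ht => ?_
  unfold ellIntegrand
  rcases lt_or_eq_of_le ht.2 with h1 | h1
  · have ht2 : t ^ 2 ≤ 1 := by nlinarith [ht.1]
    have h1' : 0 < 1 - t ^ 2 := by nlinarith [ht.1]
    have h2' : 0 < 1 - v * t ^ 2 := by nlinarith
    apply one_div_le_one_div_of_le (Real.sqrt_pos.mpr (mul_pos h1' h2'))
    apply Real.sqrt_le_sqrt
    apply mul_le_mul_of_nonneg_left _ h1'.le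
    nlinarith [sq_nonneg t]
  · subst h1
    simp



/-- `K(0) = π/2` (`∫₀¹ dt/√(1-t²) = arcsin 1 - arcsin 0`). [folklore] -/
theorem ellipticK_zero : ellipticK 0 = Real.pi / 2 := by
  have hK : ellipticK 0 = ∫ t in (0:ℝ)..1, 1 / Real.sqrt (1 - t ^ 2) := by
    rw [ellipticK_eq]
    refine intervalIntegral.integral_congr fun t _ => ?_
    simp [ellIntegrand]
  have hint : IntervalIntegrable (fun t : ℝ => 1 / Real.sqrt (1 - t ^ 2)) volume 0 1 := by
    refine (intervalIntegrable_ellIntegrand_of_lt_one (u := 0) zero_lt_one).congr fun t _ => ?_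
    simp [ellIntegrand]
  rw [hK, intervalIntegral.integral_eq_sub_of_hasDerivAt_of_le zero_le_one
    Real.continuous_arcsin.continuousOn
    (fun t ht => Real.hasDerivAt_arcsin (by linarith [ht.1]) ht.2.ne) hint,
    Real.arcsin_one, Real.arcsin_zero, sub_zero]

/-- `π/2 ≤ K(u)` for `0 ≤ u < 1`. [folklore] -/
theorem pi_div_two_le_ellipticK {u : ℝ} (hu0 : 0 ≤ u) (hu : u < 1) : Real.pi / 2 ≤ ellipticK u :=
  ellipticK_zero ▸ ellipticK_mono hu0 hu

/-- `K` is strictly monotone on `(-∞, 1)` (the integrands compare strictly on `(0,1)`). [folklore] -/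
theorem ellipticK_strictMonoOn : StrictMonoOn ellipticK (Iio 1) := by
  intro u hu v hv huv
  have hu1 : u < 1 := hu
  have hv1 : v < 1 := hv
  rw [ellipticK_eq, ellipticK_eq]
  refine intervalIntegral.integral_lt_integral_of_ae_le_of_measure_setOf_lt_ne_zero zero_le_one
    (intervalIntegrable_ellIntegrand_of_lt_one hu1) (intervalIntegrable_ellIntegrand_of_lt_one hv1)
    ?_ ?_
  · refine (ae_restrict_mem measurableSet_Ioc).mono fun t ht => ?_
    show ellIntegrand u t ≤ ellIntegrand v t
    unfold ellIntegrand
    rcases lt_or_eq_of_le ht.2 with h1 | h1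
    · have h1' : 0 < 1 - t ^ 2 := by nlinarith [ht.1]
      have h2' : 0 < 1 - v * t ^ 2 := by nlinarith [ht.1]
      apply one_div_le_one_div_of_le (Real.sqrt_pos.mpr (mul_pos h1' h2'))
      apply Real.sqrt_le_sqrt
      apply mul_le_mul_of_nonneg_left _ h1'.le
      nlinarith [sq_nonneg t]
    · subst h1
      simp
  · rw [Measure.restrict_apply' measurableSet_Ioc]
    apply ne_of_gt
    calc (0 : ENNReal) < volume (Ioo (0:ℝ) 1) := by simp
      _ ≤ volume ({t : ℝ | ellIntegrand u t < ellIntegrand v t} ∩ Ioc 0 1) := by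
        refine measure_mono fun t ht => ⟨?_, Ioo_subset_Ioc_self ht⟩
        show ellIntegrand u t < ellIntegrand v t
        unfold ellIntegrand
        have h1' : 0 < 1 - t ^ 2 := by nlinarith [ht.1, ht.2]
        have h2' : 0 < 1 - v * t ^ 2 := by nlinarith [ht.1, ht.2]
        have ht2 : 0 < t ^ 2 := by have := ht.1; positivity
        apply one_div_lt_one_div_of_lt (Real.sqrt_pos.mpr (mul_pos h1' h2'))
        apply Real.sqrt_lt_sqrt (mul_pos h1' h2').le
        apply mul_lt_mul_of_pos_left _ h1'
        nlinarith

/-! ### Continuity in the parameter -/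

/-- `K` is continuous at every `u₀ < 1` (dominated convergence with the majorant of
`ellIntegrand_le_uniform` for `u ≤ (1+u₀)/2`). [folklore] -/
theorem continuousAt_ellipticK {u₀ : ℝ} (hu₀ : u₀ < 1) : ContinuousAt ellipticK u₀ := by
  have hu₁ : (1 + u₀) / 2 < 1 := by linarith
  have hlt : u₀ < (1 + u₀) / 2 := by linarith
  have hnhds : ∀ᶠ u in 𝓝 u₀, u < (1 + u₀) / 2 := Iio_mem_nhds hlt
  show ContinuousAt (fun u => ∫ t in (0:ℝ)..1, ellIntegrand u t) u₀
  refine intervalIntegral.continuousAt_of_dominated_interval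
    (bound := fun t => (min 1 (1 - (1 + u₀) / 2)) ^ (-(1 / 2 : ℝ)) * (1 - t) ^ (-(1 / 2 : ℝ)))
    (Eventually.of_forall fun u => (measurable_ellIntegrand u).aestronglyMeasurable)
    ?_ ?_ ?_
  · refine hnhds.mono fun u hu => Eventually.of_forall fun t ht => ?_
    rw [uIoc_of_le zero_le_one] at ht
    rw [Real.norm_eq_abs, abs_of_nonneg (ellIntegrand_nonneg u t)]
    rcases lt_or_eq_of_le ht.2 with h1 | h1
    · exact ellIntegrand_le_uniform hu.le hu₁ ht.1.le h1
    · subst h1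
      have h0 : (1 - (1 : ℝ)) ^ (-(1 / 2 : ℝ)) = 0 := by
        rw [sub_self, Real.zero_rpow (by norm_num)]
      rw [h0, mul_zero]
      simp [ellIntegrand]
  · have h := (intervalIntegral.intervalIntegrable_rpow' (a := 1) (b := 0)
      (show (-1 : ℝ) < -(1 / 2) by norm_num)).comp_sub_left 1
    simp only [sub_self, sub_zero] at h
    exact h.const_mul _
  · refine Eventually.of_forall fun t ht => ?_
    rw [uIoc_of_le zero_le_one] at ht
    rcases lt_or_eq_of_le ht.2 with h1 | h1
    · have h1' : 0 < 1 - t ^ 2 := by nlinarith [ht.1]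
      have h2' : 0 < 1 - u₀ * t ^ 2 := by nlinarith [ht.1]
      have hne : Real.sqrt ((1 - t ^ 2) * (1 - u₀ * t ^ 2)) ≠ 0 :=
        (Real.sqrt_pos.mpr (mul_pos h1' h2')).ne'
      show ContinuousAt (fun u : ℝ => 1 / Real.sqrt ((1 - t ^ 2) * (1 - u * t ^ 2))) u₀
      exact ContinuousAt.div continuousAt_const (by fun_prop) hne
    · subst h1
      have : (fun u : ℝ => ellIntegrand u 1) = fun _ => 0 := by
        funext u; simp [ellIntegrand]
      rw [this]
      exact continuousAt_const

/-- `K` is continuous on `(-∞, 1)`. [folklore] -/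
theorem continuousOn_ellipticK : ContinuousOn ellipticK (Iio 1) :=
  fun _ hu => (continuousAt_ellipticK hu).continuousWithinAt

/-! ### Divergence at `u → 1⁻` -/

/-- `∫₀¹ dt/(2(1-t)+ε) = ½ log((2+ε)/ε)` for `ε > 0`. [folklore] -/
theorem integral_one_div_two_mul_one_sub_add {ε : ℝ} (hε : 0 < ε) :
    ∫ t in (0:ℝ)..1, 1 / (2 * (1 - t) + ε) = 1 / 2 * Real.log ((2 + ε) / ε) := by
  have hfun : ∀ t : ℝ, 1 / (2 * (1 - t) + ε) = ((2 + ε) - 2 * t)⁻¹ := fun t => by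
    rw [one_div]; congr 1; ring
  simp_rw [hfun]
  have key := intervalIntegral.integral_comp_sub_mul (a := 0) (b := 1) (fun x : ℝ => x⁻¹)
    (two_ne_zero) (2 + ε)
  beta_reduce at key
  rw [key, show (2 + ε) - 2 * 1 = ε by ring, show (2 + ε) - 2 * 0 = 2 + ε by ring,
    integral_inv_of_pos hε (by linarith), smul_eq_mul]
  ring

/-- **Logarithmic lower bound**: for `u < 1`, `½ log((3-u)/(1-u)) ≤ K(u)`. [folklore] -/
theorem log_le_ellipticK {u : ℝ} (hu : u < 1) :
    1 / 2 * Real.log ((3 - u) / (1 - u)) ≤ ellipticK u := by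
  have hε : 0 < 1 - u := by linarith
  rw [show (3 - u) = 2 + (1 - u) by ring, ← integral_one_div_two_mul_one_sub_add hε,
    ellipticK_eq]
  have hcont : ContinuousOn (fun t : ℝ => 1 / (2 * (1 - t) + (1 - u))) (uIcc 0 1) := by
    rw [uIcc_of_le zero_le_one]
    refine ContinuousOn.div continuousOn_const (by fun_prop) fun t ht => ?_
    have : 0 < 2 * (1 - t) + (1 - u) := by linarith [ht.2]
    exact this.ne'
  refine intervalIntegral.integral_mono_ae_restrict zero_le_one hcont.intervalIntegrable
    (intervalIntegrable_ellIntegrand_of_lt_one hu) ?_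
  rw [← Measure.restrict_congr_set Ioo_ae_eq_Icc]
  refine (ae_restrict_mem measurableSet_Ioo).mono fun t ht => ?_
  exact one_div_le_ellIntegrand hu.le ht.1.le ht.2

/-- **`K(u) → ∞` as `u → 1⁻`**, quantitatively: for every `M` there is `u₀ ∈ [0,1)` with
`M ≤ K(u)` for all `u ∈ [u₀, 1)`. [folklore] -/
theorem ellipticK_unbounded (M : ℝ) :
    ∃ u₀ : ℝ, 0 ≤ u₀ ∧ u₀ < 1 ∧ ∀ u, u₀ ≤ u → u < 1 → M ≤ ellipticK u := by
  set ε := min 1 (2 * Real.exp (-(2 * M))) with hε_def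
  have hε : 0 < ε := lt_min one_pos (by positivity)
  have hε1 : ε ≤ 1 := min_le_left _ _
  have hε2 : ε ≤ 2 * Real.exp (-(2 * M)) := min_le_right _ _
  refine ⟨1 - ε, by linarith, by linarith, fun u hu0 hu1 => ?_⟩
  have hexp : Real.exp (2 * M) * (2 * Real.exp (-(2 * M))) = 2 := by
    rw [Real.exp_neg]
    field_simp
  calc M = 1 / 2 * Real.log (Real.exp (2 * M)) := by rw [Real.log_exp]; ring
    _ ≤ 1 / 2 * Real.log ((2 + ε) / ε) := by
        gcongr
        rw [le_div_iff₀ hε]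
        calc Real.exp (2 * M) * ε ≤ Real.exp (2 * M) * (2 * Real.exp (-(2 * M))) := by gcongr
          _ = 2 := hexp
          _ ≤ 2 + ε := by linarith
    _ = 1 / 2 * Real.log ((3 - (1 - ε)) / (1 - (1 - ε))) := by
        congr 2; ring
    _ ≤ ellipticK (1 - ε) := log_le_ellipticK (by linarith)
    _ ≤ ellipticK u := ellipticK_mono hu0 hu1

/-! ### Existence of singular moduli -/

/-- **Existence of a modulus with prescribed ratio `K′/K`**: for every `c > 0` there is
`0 < k < 1` with `K(1-k²) = c · K(k²)`, i.e. `K′(k)/K(k) = c` in Jacobi's notation. With `c = √N`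
this is the existence of the `N`-th singular modulus `k_N` (Borwein–Borwein, *Pi and the AGM*,
Ch. 4–5). Proof: `g(k) = K(1-k²) - c K(k²)` is continuous on `(0,1)`, `→ +∞` at `0⁺` and `→ -∞`
at `1⁻` (`ellipticK_unbounded`, `ellipticK_mono`); intermediate value theorem. [folklore] -/
theorem exists_ellipticK_compl_eq_mul {c : ℝ} (hc : 0 < c) :
    ∃ k : ℝ, 0 < k ∧ k < 1 ∧ ellipticK (1 - k ^ 2) = c * ellipticK (k ^ 2) := by
  set A := ellipticK (1 / 2) with hA
  have hA0 : 0 ≤ A := ellipticK_nonneg _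
  obtain ⟨u₀, -, hu₀1, hleft⟩ := ellipticK_unbounded (c * A + 1)
  obtain ⟨u₁, hu₁0, hu₁1, hright⟩ := ellipticK_unbounded (A / c + 1)
  -- endpoints `a < b` in `(0,1)` with `a² = min (1/4) ((1-u₀)/2)`, `b² = max (1/2) ((1+u₁)/2)`
  have hamin : 0 < min (1 / 4 : ℝ) ((1 - u₀) / 2) := lt_min (by norm_num) (by linarith)
  have hbmax : 0 < max (1 / 2 : ℝ) ((1 + u₁) / 2) := lt_max_of_lt_left (by norm_num)
  set a := Real.sqrt (min (1 / 4) ((1 - u₀) / 2)) with ha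
  set b := Real.sqrt (max (1 / 2) ((1 + u₁) / 2)) with hb
  have ha2 : a ^ 2 = min (1 / 4) ((1 - u₀) / 2) := Real.sq_sqrt hamin.le
  have hb2 : b ^ 2 = max (1 / 2) ((1 + u₁) / 2) := Real.sq_sqrt hbmax.le
  have ha_pos : 0 < a := Real.sqrt_pos.mpr hamin
  have hab : a < b := by
    apply Real.sqrt_lt_sqrt hamin.le
    calc min (1 / 4 : ℝ) ((1 - u₀) / 2) ≤ 1 / 4 := min_le_left _ _
      _ < 1 / 2 := by norm_num
      _ ≤ max (1 / 2 : ℝ) ((1 + u₁) / 2) := le_max_left _ _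
  have hb1 : b < 1 := by
    rw [show (1:ℝ) = Real.sqrt 1 by simp]
    exact Real.sqrt_lt_sqrt hbmax.le (max_lt (by norm_num) (by linarith))
  -- the function `g`
  set g : ℝ → ℝ := fun k => ellipticK (1 - k ^ 2) - c * ellipticK (k ^ 2) with hg
  have hcont : ContinuousOn g (Icc a b) := by
    intro k hk
    have hk0 : 0 < k := lt_of_lt_of_le ha_pos hk.1
    have hk1 : k < 1 := lt_of_le_of_lt hk.2 hb1
    have hk2 : k ^ 2 < 1 := by nlinarith
    have hk2' : 1 - k ^ 2 < 1 := by nlinarith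
    apply ContinuousAt.continuousWithinAt
    have e1 : ContinuousAt (fun k : ℝ => ellipticK (1 - k ^ 2)) k :=
      ContinuousAt.comp (g := ellipticK) (f := fun k : ℝ => 1 - k ^ 2)
        (continuousAt_ellipticK hk2') (by fun_prop : Continuous fun k : ℝ => 1 - k ^ 2).continuousAt
    have e2 : ContinuousAt (fun k : ℝ => ellipticK (k ^ 2)) k :=
      ContinuousAt.comp (g := ellipticK) (f := fun k : ℝ => k ^ 2)
        (continuousAt_ellipticK hk2) (by fun_prop : Continuous fun k : ℝ => k ^ 2).continuousAt
    exact e1.sub (continuousAt_const.mul e2)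
  have hga : 0 < g a := by
    have h1 : c * A + 1 ≤ ellipticK (1 - a ^ 2) := by
      refine hleft _ ?_ ?_
      · rw [ha2]
        have := min_le_right (1 / 4 : ℝ) ((1 - u₀) / 2)
        linarith
      · rw [ha2]; linarith
    have h2 : ellipticK (a ^ 2) ≤ A := by
      refine ellipticK_mono ?_ (by norm_num)
      rw [ha2]
      have := min_le_left (1 / 4 : ℝ) ((1 - u₀) / 2)
      linarith
    have h3 : c * ellipticK (a ^ 2) ≤ c * A := mul_le_mul_of_nonneg_left h2 hc.le
    show 0 < ellipticK (1 - a ^ 2) - c * ellipticK (a ^ 2)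
    linarith
  have hgb : g b < 0 := by
    have h1 : A / c + 1 ≤ ellipticK (b ^ 2) := by
      refine hright _ ?_ ?_
      · rw [hb2]
        have := le_max_right (1 / 2 : ℝ) ((1 + u₁) / 2)
        linarith
      · rw [hb2]; exact max_lt (by norm_num) (by linarith)
    have h2 : ellipticK (1 - b ^ 2) ≤ A := by
      refine ellipticK_mono ?_ (by norm_num)
      rw [hb2]
      have := le_max_left (1 / 2 : ℝ) ((1 + u₁) / 2)
      linarith
    have h3 : c * (A / c + 1) ≤ c * ellipticK (b ^ 2) := mul_le_mul_of_nonneg_left h1 hc.le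
    have h4 : c * (A / c + 1) = A + c := by field_simp
    show ellipticK (1 - b ^ 2) - c * ellipticK (b ^ 2) < 0
    linarith
  obtain ⟨k, hk, hk0⟩ := intermediate_value_Icc' hab.le hcont ⟨hgb.le, hga.le⟩
  refine ⟨k, lt_of_lt_of_le ha_pos hk.1, lt_of_le_of_lt hk.2 hb1, ?_⟩
  have : ellipticK (1 - k ^ 2) - c * ellipticK (k ^ 2) = 0 := hk0
  linarith


/-- **Uniqueness**: the modulus of `exists_ellipticK_compl_eq_mul` is unique, since
`k ↦ K(1-k²)` is strictly decreasing and `k ↦ K(k²)` strictly increasing on `(0,1)`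
(`ellipticK_strictMonoOn`). [folklore] -/
theorem existsUnique_ellipticK_compl_eq_mul {c : ℝ} (hc : 0 < c) :
    ∃! k : ℝ, 0 < k ∧ k < 1 ∧ ellipticK (1 - k ^ 2) = c * ellipticK (k ^ 2) := by
  obtain ⟨k, hk0, hk1, hk⟩ := exists_ellipticK_compl_eq_mul hc
  refine ⟨k, ⟨hk0, hk1, hk⟩, fun k' ⟨hk0', hk1', hk'⟩ => ?_⟩
  by_contra hne
  -- squares in `(0,1)`, complements in `(0,1)`
  have hsq : ∀ {x : ℝ}, 0 < x → x < 1 → x ^ 2 < 1 := fun hx0 hx1 => by nlinarith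
  rcases lt_or_gt_of_ne hne with hlt | hlt
  · -- k' < k
    have h1 : ellipticK (k' ^ 2) < ellipticK (k ^ 2) :=
      ellipticK_strictMonoOn (hsq hk0' hk1') (hsq hk0 hk1) (by nlinarith)
    have h2 : ellipticK (1 - k ^ 2) < ellipticK (1 - k' ^ 2) :=
      ellipticK_strictMonoOn (show 1 - k ^ 2 < 1 by nlinarith) (show 1 - k' ^ 2 < 1 by nlinarith)
        (by nlinarith)
    have h3 : c * ellipticK (k' ^ 2) < c * ellipticK (k ^ 2) := mul_lt_mul_of_pos_left h1 hc
    linarith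
  · -- k < k'
    have h1 : ellipticK (k ^ 2) < ellipticK (k' ^ 2) :=
      ellipticK_strictMonoOn (hsq hk0 hk1) (hsq hk0' hk1') (by nlinarith)
    have h2 : ellipticK (1 - k' ^ 2) < ellipticK (1 - k ^ 2) :=
      ellipticK_strictMonoOn (show 1 - k' ^ 2 < 1 by nlinarith) (show 1 - k ^ 2 < 1 by nlinarith)
        (by nlinarith)
    have h3 : c * ellipticK (k ^ 2) < c * ellipticK (k' ^ 2) := mul_lt_mul_of_pos_left h1 hc
    linarith

/-- **Existence and uniqueness of the `N`-th singular modulus** (`N > 0`): exactly one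
`0 < k < 1` has `K′(k) = √N · K(k)` (Borwein–Borwein, *Pi and the AGM*, Ch. 4–5). [folklore] -/
theorem existsUnique_singularModulus {N : ℝ} (hN : 0 < N) :
    ∃! k : ℝ, 0 < k ∧ k < 1 ∧ ellipticK (1 - k ^ 2) = Real.sqrt N * ellipticK (k ^ 2) :=
  existsUnique_ellipticK_compl_eq_mul (Real.sqrt_pos.mpr hN)

end Literature.Probability.RandomPlanarGeometry

end
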